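import Mathlib

/-!
# Kernel-definite junction, part 1: the windowed Rolle engine

Helper file for the stub `stub_kernelDefiniteJunction` of the line `junction_ceiling` (crux `MatrixDescartes`,
stmt-ValiantsHypothesis-18050).  Pure real-polynomial analysis, no matrices:

* `card_zeros_le_of_iterate_derivative_ne_zero` — windowed Rolle: if the `k`-th derivative of a real polynomial does
  not vanish on `[a, b]`, the polynomial has at most `k` distinct zeros in `[a, b]`;
* `eventually_abs_eval_sub_lt` — a family of polynomials of bounded degree converging coefficientwise converges
  uniformly on bounded sets (and so do all its derivatives, `tendsto_coeff_iterate_derivative`);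
* `eventually_card_zeros_window_le` — THE ENGINE: if `p i → q` coefficientwise (degrees `≤ D`, `q ≠ 0`) and
  `q a ≠ 0`, `q b ≠ 0`, then eventually every finite set of zeros of `p i` inside `[a, b]` has at most as many elements
  as `q` has roots in `(a, b)` COUNTED WITH MULTIPLICITY (near a root of multiplicity `μ` the `μ`-th derivative of `p i`
  does not vanish, so Rolle allows at most `μ` distinct zeros there; away from the roots `|q|` is bounded below).

This is the real-variable substitute for Hurwitz's theorem that the junction count needs (distinct roots of the
perturbed polynomial against roots-with-multiplicity of the limit).  [folklore]
-/

set_option autoImplicit false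

namespace Summit.ValiantsHypothesis.ValiantsHypothesis.Theorems.LacunarySymmetroidMatrixDescartes.JunctionCeiling

open Polynomial Filter Set Topology
open scoped BigOperators

/-! ## 1. Windowed Rolle -/

/-- One Rolle step inside a window: a finite set of zeros of `p` in `[a, b]` has at most one more element than the
set of zeros of `p'` in `[a, b]` (for `p' ≠ 0`). [folklore] -/
theorem card_zeros_le_card_zeros_derivative_succ (p : ℝ[X]) (hp' : derivative p ≠ 0) (a b : ℝ)
    (Z : Finset ℝ) (hZ : ∀ t ∈ Z, t ∈ Icc a b ∧ p.eval t = 0) :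
    Z.card ≤ ((derivative p).roots.toFinset.filter (fun t => a ≤ t ∧ t ≤ b)).card + 1 := by
  refine Finset.card_le_of_interleaved fun x hx y hy hxy _ => ?_
  obtain ⟨hxI, hxr⟩ := hZ x hx
  obtain ⟨hyI, hyr⟩ := hZ y hy
  obtain ⟨z, hz1, hz2⟩ :=
    exists_deriv_eq_zero (f := fun t => p.eval t) hxy p.continuousOn (by simp only [hxr, hyr])
  refine ⟨z, ?_, hz1.1, hz1.2⟩
  rw [Finset.mem_filter, Multiset.mem_toFinset, mem_roots hp', IsRoot.def, ← p.deriv]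
  exact ⟨hz2, hxI.1.trans hz1.1.le, hz1.2.le.trans hyI.2⟩

/-- **Windowed Rolle.** If the `k`-th derivative of the real polynomial `p` has no zero on `[a, b]`, then every finite
set of zeros of `p` contained in `[a, b]` has at most `k` elements. [folklore] -/
theorem card_zeros_le_of_iterate_derivative_ne_zero (k : ℕ) :
    ∀ (p : ℝ[X]) (a b : ℝ), (∀ t ∈ Icc a b, (derivative^[k] p).eval t ≠ 0) →
      ∀ Z : Finset ℝ, (∀ t ∈ Z, t ∈ Icc a b ∧ p.eval t = 0) → Z.card ≤ k := by
  induction k with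
  | zero =>
    intro p a b hk Z hZ
    rw [Nat.le_zero, Finset.card_eq_zero, Finset.eq_empty_iff_forall_notMem]
    intro t ht
    exact hk t (hZ t ht).1 (by simpa using (hZ t ht).2)
  | succ k ih =>
    intro p a b hk Z hZ
    by_cases hab : a ≤ b
    · have hk' : ∀ t ∈ Icc a b, (derivative^[k] (derivative p)).eval t ≠ 0 := by
        intro t ht
        rw [← Function.iterate_succ_apply]
        exact hk t ht
      have hp' : derivative p ≠ 0 := by
        intro h
        refine hk' a ⟨le_rfl, hab⟩ ?_
        rw [h, iterate_derivative_zero, eval_zero]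
      set Z' : Finset ℝ := (derivative p).roots.toFinset.filter (fun t => a ≤ t ∧ t ≤ b) with hZ'
      have h1 : Z.card ≤ Z'.card + 1 := card_zeros_le_card_zeros_derivative_succ p hp' a b Z hZ
      have h2 : Z'.card ≤ k := by
        refine ih (derivative p) a b hk' Z' fun t ht => ?_
        rw [hZ', Finset.mem_filter, Multiset.mem_toFinset, mem_roots hp'] at ht
        exact ⟨⟨ht.2.1, ht.2.2⟩, ht.1⟩
      omega
    · have hZe : Z = ∅ := by
        rw [Finset.eq_empty_iff_forall_notMem]
        intro t ht
        have h := (hZ t ht).1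
        exact hab (h.1.trans h.2)
      simp [hZe]

/-! ## 2. Coefficientwise convergence ⇒ uniform convergence on bounded sets -/

/-- A polynomial of degree `< D + 1` is bounded on `|t| ≤ M` by the `ℓ¹`-norm of its coefficients times `max M 1 ^ D`.
[folklore] -/
theorem abs_eval_le_sum_abs_coeff (r : ℝ[X]) (D : ℕ) (hr : r.natDegree ≤ D) (M t : ℝ) (ht : |t| ≤ M) :
    |r.eval t| ≤ (∑ k ∈ Finset.range (D + 1), |r.coeff k|) * (max M 1) ^ D := by
  rw [eval_eq_sum_range' (Nat.lt_succ_of_le hr), Finset.sum_mul]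
  refine (Finset.abs_sum_le_sum_abs _ _).trans (Finset.sum_le_sum fun k hk => ?_)
  rw [abs_mul, abs_pow]
  refine mul_le_mul_of_nonneg_left ?_ (abs_nonneg _)
  have hM1 : 1 ≤ max M 1 := le_max_right _ _
  calc |t| ^ k ≤ (max M 1) ^ k := by
        exact pow_le_pow_left₀ (abs_nonneg t) (ht.trans (le_max_left _ _)) k
    _ ≤ (max M 1) ^ D := pow_le_pow_right₀ hM1 (by simpa [Finset.mem_range, Nat.lt_succ_iff] using hk)

/-- **Coefficientwise ⇒ locally uniform.** If `p i → q` coefficientwise and all degrees are `≤ D`, then for every bound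
`M` and every `ε > 0`, eventually `|p i (t) − q (t)| < ε` for all `|t| ≤ M`. [folklore] -/
theorem eventually_abs_eval_sub_lt {ι : Type*} {l : Filter ι} (p : ι → ℝ[X]) (q : ℝ[X]) (D : ℕ)
    (hdeg : ∀ i, (p i).natDegree ≤ D) (hq : q.natDegree ≤ D)
    (hconv : ∀ k, Tendsto (fun i => (p i).coeff k) l (𝓝 (q.coeff k)))
    (M : ℝ) {ε : ℝ} (hε : 0 < ε) :
    ∀ᶠ i in l, ∀ t : ℝ, |t| ≤ M → |(p i).eval t - q.eval t| < ε := by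
  set B : ℝ := (max M 1) ^ D with hB
  have hBpos : 0 < B := by positivity
  set η : ℝ := ε / (2 * ((D : ℝ) + 1) * B) with hη
  have hηpos : 0 < η := by positivity
  have hev : ∀ᶠ i in l, ∀ k ∈ Finset.range (D + 1), |(p i).coeff k - q.coeff k| < η := by
    rw [Finset.eventually_all]
    intro k _
    have h := (hconv k).sub_const (q.coeff k)
    rw [sub_self] at h
    have h2 := (continuous_abs.tendsto (0 : ℝ)).comp h
    rw [abs_zero] at h2
    exact h2.eventually (Iio_mem_nhds hηpos)
  refine hev.mono fun i hi t ht => ?_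
  have hdeg' : (p i - q).natDegree ≤ D := (natDegree_sub_le _ _).trans (max_le (hdeg i) hq)
  rw [← eval_sub]
  refine (abs_eval_le_sum_abs_coeff (p i - q) D hdeg' M t ht).trans_lt ?_
  have hsum : (∑ k ∈ Finset.range (D + 1), |(p i - q).coeff k|) ≤ ((D : ℝ) + 1) * η := by
    calc (∑ k ∈ Finset.range (D + 1), |(p i - q).coeff k|)
        ≤ ∑ _k ∈ Finset.range (D + 1), η := Finset.sum_le_sum fun k hk => by
            rw [coeff_sub]; exact (hi k hk).le
      _ = ((D : ℝ) + 1) * η := by simp [Finset.sum_const, Finset.card_range]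
  calc (∑ k ∈ Finset.range (D + 1), |(p i - q).coeff k|) * B ≤ ((D : ℝ) + 1) * η * B :=
        mul_le_mul_of_nonneg_right hsum hBpos.le
    _ = ε / 2 := by rw [hη]; field_simp
    _ < ε := by linarith

/-- Iterated derivatives of a coefficientwise convergent family converge coefficientwise. [folklore] -/
theorem tendsto_coeff_iterate_derivative {ι : Type*} {l : Filter ι} (p : ι → ℝ[X]) (q : ℝ[X])
    (hconv : ∀ k, Tendsto (fun i => (p i).coeff k) l (𝓝 (q.coeff k))) (n k : ℕ) :
    Tendsto (fun i => (derivative^[n] (p i)).coeff k) l (𝓝 ((derivative^[n] q).coeff k)) := by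
  simp only [coeff_iterate_derivative, nsmul_eq_mul]
  exact (hconv (k + n)).const_mul _

/-- Iterated derivatives do not raise the degree. [folklore] -/
theorem natDegree_iterate_derivative_le_of_le (r : ℝ[X]) (n D : ℕ) (h : r.natDegree ≤ D) :
    (derivative^[n] r).natDegree ≤ D :=
  (natDegree_iterate_derivative r n).trans ((Nat.sub_le _ _).trans h)

/-! ## 3. Multiplicity and the nonvanishing derivative -/

/-- At a root of multiplicity `μ` of a nonzero real polynomial the `μ`-th derivative does not vanish. [folklore] -/
theorem eval_iterate_derivative_rootMultiplicity_ne_zero (q : ℝ[X]) (hq : q ≠ 0) (r : ℝ) :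
    (derivative^[q.rootMultiplicity r] q).eval r ≠ 0 := by
  have h := (lt_rootMultiplicity_iff_isRoot_iterate_derivative (t := r) (n := q.rootMultiplicity r) hq).not.1
    (lt_irrefl _)
  push Not at h
  obtain ⟨m, hm, hmr⟩ := h
  rcases hm.lt_or_eq with hlt | heq
  · exact absurd (isRoot_iterate_derivative_of_lt_rootMultiplicity hlt) hmr
  · rw [heq] at hmr
    exact hmr

/-! ## 4. The engine -/

/-- **THE ENGINE (root ceiling under coefficientwise convergence).**  Let `p i → q` coefficientwise along a filter `l`,
all degrees `≤ D`, `q ≠ 0`, and let `[a, b]` be a window whose endpoints are not roots of `q`.  Then eventually along `l`,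
every finite set of zeros of `p i` contained in `[a, b]` has at most as many elements as `q` has roots in `(a, b)` counted
with multiplicity. [folklore] -/
theorem eventually_card_zeros_window_le {ι : Type*} {l : Filter ι} (p : ι → ℝ[X]) (q : ℝ[X]) (D : ℕ)
    (hdeg : ∀ i, (p i).natDegree ≤ D) (hq0 : q ≠ 0) (hqD : q.natDegree ≤ D)
    (hconv : ∀ k, Tendsto (fun i => (p i).coeff k) l (𝓝 (q.coeff k)))
    (a b : ℝ) (ha : q.eval a ≠ 0) (hb : q.eval b ≠ 0) :
    ∀ᶠ i in l, ∀ Z : Finset ℝ, (∀ t ∈ Z, t ∈ Icc a b ∧ (p i).eval t = 0) →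
      Z.card ≤ Multiset.card (q.roots.filter (fun t => a < t ∧ t < b)) := by
  classical
  -- the distinct roots of `q` in the open window and their multiplicities
  set Rts : Finset ℝ := (q.roots.filter (fun t => a < t ∧ t < b)).toFinset with hRts
  have hRts_mem : ∀ r, r ∈ Rts ↔ q.eval r = 0 ∧ a < r ∧ r < b := by
    intro r
    rw [hRts, Multiset.mem_toFinset, Multiset.mem_filter, mem_roots hq0, IsRoot.def]
  set μ : ℝ → ℕ := fun r => q.rootMultiplicity r with hμ
  set dq : ℝ → ℝ[X] := fun r => derivative^[μ r] q with hdq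
  have hdq_ne : ∀ r, (dq r).eval r ≠ 0 := fun r => eval_iterate_derivative_rootMultiplicity_ne_zero q hq0 r
  -- one radius `δ` for all roots
  have hδ : ∃ δ : ℝ, 0 < δ ∧
      (∀ r ∈ Rts, (a < r - δ ∧ r + δ < b) ∧
        ∀ t : ℝ, |t - r| ≤ δ → |(dq r).eval t - (dq r).eval r| < |(dq r).eval r| / 2) ∧
      (∀ r ∈ Rts, ∀ r' ∈ Rts, r ≠ r' → 2 * δ < |r - r'|) := by
    have hev : ∀ᶠ δ in 𝓝[>] (0 : ℝ), 0 < δ ∧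
        (∀ r ∈ Rts, (a < r - δ ∧ r + δ < b) ∧
          ∀ t : ℝ, |t - r| ≤ δ → |(dq r).eval t - (dq r).eval r| < |(dq r).eval r| / 2) ∧
        (∀ r ∈ Rts, ∀ r' ∈ Rts, r ≠ r' → 2 * δ < |r - r'|) := by
      have h0 : ∀ᶠ δ in 𝓝[>] (0 : ℝ), 0 < δ := eventually_mem_nhdsWithin
      have hsmall : ∀ c : ℝ, 0 < c → ∀ᶠ δ in 𝓝[>] (0 : ℝ), δ < c := fun c hc =>
        mem_nhdsWithin_of_mem_nhds (Iio_mem_nhds hc)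
      refine h0.and ((?_ : ∀ᶠ δ in 𝓝[>] (0 : ℝ), _).and ?_)
      · rw [Finset.eventually_all]
        intro r hr
        obtain ⟨_, har, hrb⟩ := (hRts_mem r).1 hr
        have hcont : ContinuousAt (fun t => (dq r).eval t) r := (dq r).continuous.continuousAt
        obtain ⟨δr, hδr, hδr'⟩ := Metric.continuousAt_iff.1 hcont (|(dq r).eval r| / 2)
          (by have := hdq_ne r; positivity)
        refine ((hsmall (r - a) (by linarith)).and ((hsmall (b - r) (by linarith)).and
          (hsmall δr hδr))).mono fun δ hδ => ⟨⟨by linarith [hδ.1], by linarith [hδ.2.1]⟩, fun t ht => ?_⟩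
        have hd : dist t r < δr := by rw [Real.dist_eq]; linarith [hδ.2.2]
        have := hδr' hd
        rwa [Real.dist_eq] at this
      · rw [Finset.eventually_all]
        intro r _
        rw [Finset.eventually_all]
        intro r' _
        by_cases hrr : r = r'
        · exact Eventually.of_forall fun δ h => absurd hrr h
        · have hpos : 0 < |r - r'| / 2 := by
            have : r - r' ≠ 0 := sub_ne_zero.2 hrr
            positivity
          exact (hsmall _ hpos).mono fun δ hδ _ => by linarith
    obtain ⟨δ, hδ⟩ := hev.exists
    exact ⟨δ, hδ.1, hδ.2.1, hδ.2.2⟩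
  obtain ⟨δ, hδpos, hδroot, hδsep⟩ := hδ
  -- away from the roots `|q|` is bounded below on the window
  set K : Set ℝ := Icc a b ∩ ⋂ r ∈ Rts, (Ioo (r - δ) (r + δ))ᶜ with hK
  have hKc : IsCompact K :=
    isCompact_Icc.inter_right (isClosed_biInter fun r _ => isOpen_Ioo.isClosed_compl)
  have hKq : ∀ t ∈ K, 0 < |q.eval t| := by
    intro t ht
    rw [abs_pos]
    intro hqt
    rw [hK, mem_inter_iff, mem_iInter₂] at ht
    have hta : t ≠ a := fun h => ha (h ▸ hqt)
    have htb : t ≠ b := fun h => hb (h ▸ hqt)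
    have htR : t ∈ Rts := (hRts_mem t).2 ⟨hqt, lt_of_le_of_ne ht.1.1 hta.symm, lt_of_le_of_ne ht.1.2 htb⟩
    exact ht.2 t htR ⟨by linarith, by linarith⟩
  obtain ⟨η, hηpos, hηK⟩ := hKc.exists_forall_le' (f := fun t => |q.eval t|)
    (q.continuous.abs.continuousOn) (a := 0) hKq
  -- the eventual estimates
  set M : ℝ := max |a| |b| with hM
  have hMab : ∀ t ∈ Icc a b, |t| ≤ M := fun t ht =>
    (abs_le_max_abs_abs ht.1 ht.2).trans le_rfl
  have hE1 := eventually_abs_eval_sub_lt p q D hdeg hqD hconv M hηpos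
  have hE2 : ∀ᶠ i in l, ∀ r ∈ Rts, ∀ t : ℝ, |t| ≤ M →
      |(derivative^[μ r] (p i)).eval t - (dq r).eval t| < |(dq r).eval r| / 2 := by
    rw [Finset.eventually_all]
    intro r _
    exact eventually_abs_eval_sub_lt (fun i => derivative^[μ r] (p i)) (dq r) D
      (fun i => natDegree_iterate_derivative_le_of_le _ _ _ (hdeg i))
      (natDegree_iterate_derivative_le_of_le _ _ _ hqD)
      (tendsto_coeff_iterate_derivative p q hconv (μ r)) M (by have := hdq_ne r; positivity)
  filter_upwards [hE1, hE2] with i hi1 hi2 Z hZ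
  -- every zero of `p i` in the window is `δ`-close to a root of `q`
  have hcover : Z ⊆ Rts.biUnion (fun r => Z.filter (fun t => r - δ < t ∧ t < r + δ)) := by
    intro t ht
    obtain ⟨htI, hpt⟩ := hZ t ht
    rw [Finset.mem_biUnion]
    by_contra hnot
    push Not at hnot
    have htK : t ∈ K := by
      rw [hK, mem_inter_iff, mem_iInter₂]
      refine ⟨htI, fun r hr hin => ?_⟩
      have := hnot r hr
      rw [Finset.mem_filter] at this
      exact this ⟨ht, hin.1, hin.2⟩
    have h1 := hηK t htK
    have h2 := hi1 t (hMab t htI)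
    rw [hpt, zero_sub, abs_neg] at h2
    linarith
  -- near each root: windowed Rolle with `k = μ r`
  have hlocal : ∀ r ∈ Rts, (Z.filter (fun t => r - δ < t ∧ t < r + δ)).card ≤ μ r := by
    intro r hr
    obtain ⟨⟨har, hrb⟩, hcont⟩ := hδroot r hr
    refine card_zeros_le_of_iterate_derivative_ne_zero (μ r) (p i) (r - δ) (r + δ) ?_ _ ?_
    · intro t ht hzero
      have htM : |t| ≤ M := hMab t ⟨by linarith [ht.1], by linarith [ht.2]⟩
      have h1 := hi2 r hr t htM
      have h2 := hcont t (abs_le.2 ⟨by linarith [ht.1], by linarith [ht.2]⟩)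
      rw [hzero, zero_sub, abs_neg] at h1
      have h3 : |(dq r).eval r| ≤ |(dq r).eval t| + |(dq r).eval t - (dq r).eval r| := by
        have := abs_sub_abs_le_abs_sub ((dq r).eval r) ((dq r).eval t)
        rw [abs_sub_comm] at this
        linarith
      have h4 : 0 < |(dq r).eval r| := abs_pos.2 (hdq_ne r)
      linarith
    · intro t ht
      rw [Finset.mem_filter] at ht
      exact ⟨⟨ht.2.1.le, ht.2.2.le⟩, (hZ t ht.1).2⟩
  -- add up
  calc Z.card ≤ (Rts.biUnion (fun r => Z.filter (fun t => r - δ < t ∧ t < r + δ))).card :=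
        Finset.card_le_card hcover
    _ ≤ ∑ r ∈ Rts, (Z.filter (fun t => r - δ < t ∧ t < r + δ)).card := Finset.card_biUnion_le
    _ ≤ ∑ r ∈ Rts, μ r := Finset.sum_le_sum hlocal
    _ = Multiset.card (q.roots.filter (fun t => a < t ∧ t < b)) := by
        rw [hRts, ← Multiset.toFinset_sum_count_eq]
        refine Finset.sum_congr rfl fun r hr => ?_
        have hr' := (hRts_mem r).1 (hRts ▸ hr)
        rw [hμ]
        simp only
        rw [Multiset.count_filter_of_pos (by exact ⟨hr'.2.1, hr'.2.2⟩), count_roots]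

end Summit.ValiantsHypothesis.ValiantsHypothesis.Theorems.LacunarySymmetroidMatrixDescartes.JunctionCeiling
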